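import Mathlib
import Summits.Ventures.FusionMHD.Models.CerfonFreidbergNstxLikeQHalfGGJ
import Summits.Ventures.FusionMHD.Models.CerfonFreidbergIterLikeQHalfGGJHalf
import Summits.Ventures.FusionMHD.Models.FluxSurfacePolarRayLevelGGJHalf
import HarnessLib

/-!
# Ventures/FusionMHD — Models/CerfonFreidbergNstxLikeQHalfGGJHalf.lean: the Mercier criterion at `ψ_N = 1/2` of THE Cerfon–Freidberg
# NSTX-like flux as ONE polynomial inequality in the SIX `[0, π]` registers of the NSTX-like chain's 32-panel half (up–down symmetry)

HONEST FRAMING (LADDER-GRIDFUSION three columns; CF rung, F2 item R2; «F2.R2-POLAR-GGJ-DATA» instance part 2, LOW, no count).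
Companion of `Models/CerfonFreidbergIterLikeQHalfGGJ.lean` (the record `QHalf.ggjData F u`, the fields `Dfield`, `F2field`, `Gfield`,
`mercierCriterion_iff` with `[0, 2π]` registers) and of model-7's generic `Models/FluxSurfacePolarRayLevelGGJHalf.lean`
(`LevelLoop.mercierCriterion_ggjData_iff_half`).
* CERTIFIED (kernel; this file + imports, axioms standard): the second ray derivative field `F2field` and the gradient-squared field
  `Gfield` of THE flux are EVEN and `2π`-PERIODIC in `θ` (closed forms: `U_XX`, `U_YY`, `U_X` even in `Y`, `U_XY`, `U_Y` odd); hence,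
  with `CFNstxLike.U(X, −Y) = CFNstxLike.U(X, Y)` (`UN_neg`) and `Dfield_neg/periodic`, for every level `u` with `|u − u₀| < 10⁻¹²` and at `u₀` (`ψ_N = 1/2`):
  **`mercierCriterion_iff_halfLoop` / `mercierCriterion_half_iff_halfLoop`** — Jardin's criterion (8.134) on the surface ⟺
  `0 < PolarRay.mercierRegisterForm F 1 (∫₀^π polarKernelDs/Dfield) (∫₀^π volKernelDs/Dfield) (∫₀^π invGradKernel) (∫₀^π sigmaSqKernel)
  (∫₀^π bsqGradKernel) (∫₀^π invBsqKernel)` along the certified radius — exactly the register shape of the 32-panel program on `[0, π]`.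
* VALIDATED: nothing used; no register values computed for the NSTX-like surface in this cell (the ITER-like ones are in MODEL-7-NOTES §6).
* MODELLED: analytic Cerfon–Freidberg family, ideal MHD; NECESSARY criterion of the MODEL — never «stable», never a device.
Typer/prover: gridfusion-model-7 (g6; NSTX-like twin = the ITER-like text with the NSTX-like objects), 2026-08-27.  Citations: Jardin 2010 (8.134) [Jardin2010]; Freidberg 2014 (6.153) [Freidberg2014].
-/

noncomputable section

open Set MeasureTheory intervalIntegral Filter Topology
open Literature.MathematicalPhysics.MHD Literature.MathematicalPhysics.MHD.CerfonFreidberg Literature.MathematicalPhysics.MHD.GradShafranov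
  Literature.MathematicalPhysics.MHD.FluxGeometry Literature.MathematicalPhysics.MHD.Mercier.FluxForm
open Summit.Ventures.FusionMHD.Models.PolarRay
open Summit.Ventures.FusionMHD.Models.CFIterLike.QHalf (UXc UYc UXXc UXYc UYYc UXc_negY UYc_negY UXXc_negY UXYc_negY UYYc_negY)

namespace Summit.Ventures.FusionMHD.Models.CFNstxLike.QHalf

/-! ## §1 Parity in `Y` of the second partials; `F2field`, `Gfield` are even and `2π`-periodic in `θ` -/

/-- `F2field = ∂_s D_r` is even in `θ`. -/
theorem F2field_neg (θ s : ℝ) : CFNstxLike.QHalf.F2field (-θ) s = F2field θ s := by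
  unfold F2field CFIterLike.QHalf.F2c
  rw [Real.cos_neg, Real.sin_neg, show s * -Real.sin θ = -(s * Real.sin θ) by ring, UXXc_negY, UXYc_negY, UYYc_negY]
  ring

/-- `F2field` is `2π`-periodic in `θ`. -/
theorem F2field_periodic (θ s : ℝ) : CFNstxLike.QHalf.F2field (θ + 2 * Real.pi) s = F2field θ s := by
  unfold F2field CFIterLike.QHalf.F2c
  rw [Real.cos_add_two_pi, Real.sin_add_two_pi]

/-- `Gfield = |∇CFNstxLike.U|²` along rays is even in `θ`. -/
theorem Gfield_neg (θ s : ℝ) : CFNstxLike.QHalf.Gfield (-θ) s = Gfield θ s := by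
  unfold Gfield
  rw [Real.cos_neg, Real.sin_neg, show s * -Real.sin θ = -(s * Real.sin θ) by ring, UXc_negY, UYc_negY]
  ring

/-- `Gfield` is `2π`-periodic in `θ`. -/
theorem Gfield_periodic (θ s : ℝ) : CFNstxLike.QHalf.Gfield (θ + 2 * Real.pi) s = Gfield θ s := by
  unfold Gfield
  rw [Real.cos_add_two_pi, Real.sin_add_two_pi]

/-- The flux is mirror-symmetric about the midplane through the axis `(X_a, 0)`: `CFNstxLike.U(X, 0 − z) = CFNstxLike.U(X, 0 + z)`. -/
theorem U_symm (X z : ℝ) : CFNstxLike.U X (0 - z) = CFNstxLike.U X (0 + z) := by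
  rw [zero_sub, zero_add]; exact UN_neg X z

/-! ## §2 The criterion with the six `[0, π]` registers -/

/-- **(8.134) ON THE SURFACE `CFNstxLike.U = u` (`|u − u₀| < 10⁻¹²`) ⟺ `0 < mercierRegisterForm F 1` OF THE SIX `[0, π]` REGISTERS** along `ρ_u`
(fields `Dfield`, `F2field`, `Gfield`).  No value claimed. [cite: Jardin2010, §8.5.4 eq. (8.134)] -/
theorem mercierCriterion_iff_halfLoop {u : ℝ} (hu : u ∈ Ioo (u₀ - ((δQ : ℚ) : ℝ)) (u₀ + ((δQ : ℚ) : ℝ))) (F : ℝ) :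
    (ggjData F u).MercierCriterion ↔
    0 < mercierRegisterForm F 1
      (∫ θ in (0 : ℝ)..Real.pi, polarKernelDs CFNstxLike.Xa Dfield F2field θ (rayRadius CFNstxLike.U CFNstxLike.Xa 0 u θ) / Dfield θ (rayRadius CFNstxLike.U CFNstxLike.Xa 0 u θ))
      (∫ θ in (0 : ℝ)..Real.pi, volKernelDs CFNstxLike.Xa Dfield F2field θ (rayRadius CFNstxLike.U CFNstxLike.Xa 0 u θ) / Dfield θ (rayRadius CFNstxLike.U CFNstxLike.Xa 0 u θ))
      (∫ θ in (0 : ℝ)..Real.pi, invGradKernel CFNstxLike.Xa Dfield Gfield θ (rayRadius CFNstxLike.U CFNstxLike.Xa 0 u θ))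
      (∫ θ in (0 : ℝ)..Real.pi, sigmaSqKernel F CFNstxLike.Xa Dfield Gfield θ (rayRadius CFNstxLike.U CFNstxLike.Xa 0 u θ))
      (∫ θ in (0 : ℝ)..Real.pi, bsqGradKernel F CFNstxLike.Xa Dfield Gfield θ (rayRadius CFNstxLike.U CFNstxLike.Xa 0 u θ))
      (∫ θ in (0 : ℝ)..Real.pi, invBsqKernel F CFNstxLike.Xa Dfield Gfield θ (rayRadius CFNstxLike.U CFNstxLike.Xa 0 u θ)) :=
  levelLoop.mercierCriterion_ggjData_iff_half F box_facts.1 box_facts.2 box_facts₂.1 box_facts₂.2 box_factsG box_factsGS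
    U_symm Dfield_neg Dfield_periodic F2field_neg F2field_periodic Gfield_neg Gfield_periodic hu

/-- **THE MERCIER CRITERION (8.134) AT `ψ_N = 1/2` OF THE CF NSTX-like MODEL ⟺ `0 < mercierRegisterForm F 1 Pd Wd Aσ As AB Ai` WITH
THE SIX `[0, π]` REGISTERS along the NSTX-like chain's certified radius `ρ`** — the register shape of the 32-panel program (`…QHalfData`), no doubling
(degree-two homogeneity).  What remains for a certified row: six top registers + tube constants (`LevelPanel.kernel_integral_tube`) and
one rational inequality.  NECESSARY criterion of the MODEL; no value, no sign claimed here. [cite: Jardin2010, §8.5.4 eq. (8.134)] -/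
theorem mercierCriterion_half_iff_halfLoop (F : ℝ) : (ggjData F u₀).MercierCriterion ↔
    0 < mercierRegisterForm F 1
      (∫ θ in (0 : ℝ)..Real.pi, polarKernelDs CFNstxLike.Xa Dfield F2field θ (ρ θ) / Dfield θ (ρ θ))
      (∫ θ in (0 : ℝ)..Real.pi, volKernelDs CFNstxLike.Xa Dfield F2field θ (ρ θ) / Dfield θ (ρ θ))
      (∫ θ in (0 : ℝ)..Real.pi, invGradKernel CFNstxLike.Xa Dfield Gfield θ (ρ θ))
      (∫ θ in (0 : ℝ)..Real.pi, sigmaSqKernel F CFNstxLike.Xa Dfield Gfield θ (ρ θ))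
      (∫ θ in (0 : ℝ)..Real.pi, bsqGradKernel F CFNstxLike.Xa Dfield Gfield θ (ρ θ))
      (∫ θ in (0 : ℝ)..Real.pi, invBsqKernel F CFNstxLike.Xa Dfield Gfield θ (ρ θ)) :=
  mercierCriterion_iff_halfLoop u₀_mem F

end Summit.Ventures.FusionMHD.Models.CFNstxLike.QHalf

end
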